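import Summits.ABC.ABC.Theorems.TwistAmplificationSharpModerateLawDeepModuliStationaryPhase
import Summits.ABC.ABC.Theorems.TwistAmplificationSharpModerateLawCuspDispersionDefs

/-!
# `CuspSumBound` holds — named discharge of the cusp stationary-phase statement

Line `deep-moduli-cusp-dispersion` of the crux `Summit.ABC.ABC.Theses.TwistAmplification.SharpModerateLaw`
(stmt-ABC-1975).  The registered stub `stub_cuspStationaryPhase` (`|S(h₁,h₂;pⁿ)| ≤ 2p^{n/2}` for the
complete cusp sums `S(h₁,h₂;pⁿ) = Σ_{t mod pⁿ, p ∤ t} e((h₁t² + h₂t³)/pⁿ)`, `p ≥ 5`, `n ≥ 2`, `(h₁,h₂)` not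
both divisible by `p`) is PROVED in the tree as `DeepModuli.stub_cuspStationaryPhase`
(`TwistAmplificationSharpModerateLawDeepModuliStationaryPhase.lean`, `p`-adic stationary phase,
Iwaniec–Kowalski §12.3).  This file records it under the line's named statement `CuspSumBound` of
`TwistAmplificationSharpModerateLawCuspDispersionDefs.lean` (whose `cuspSum` is the same sum, so the
proof is definitional unfolding) and derives the two regime laws that take it as hypothesis.
-/

namespace Summit.ABC.ABC.Theorems.SharpModerateLaw.CuspDispersion

/-- **`CuspSumBound` holds**: `|S(h₁,h₂;pⁿ)| ≤ 2·p^{n/2}` for `p ≥ 5` prime, `n ≥ 2`, `(h₁,h₂)` not both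
divisible by `p` — the landed `DeepModuli.stub_cuspStationaryPhase`, read through `cuspSum`. -/
theorem cuspSumBound_holds : CuspSumBound := DeepModuli.stub_cuspStationaryPhase

/-- The resolved-regime stub `ResolvedRegimeLaw = (CuspSumBound → LawOn ResolvedRegime)` now yields the
law on the resolved regime outright. -/
theorem lawOn_resolved_of_resolvedRegimeLaw (h : ResolvedRegimeLaw) : LawOn ResolvedRegime :=
  h cuspSumBound_holds

/-- The deep-regime stub `DeepRegimeLaw = (CuspSumBound → LawOn DeepRegime)` now yields the law on the
deep regime outright. -/
theorem lawOn_deep_of_deepRegimeLaw (h : DeepRegimeLaw) : LawOn DeepRegime :=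
  h cuspSumBound_holds

end Summit.ABC.ABC.Theorems.SharpModerateLaw.CuspDispersion
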